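import Summits.Ventures.HodgeRepro2.T6N41PlaceKappa

/-!
# T6N41PlaceKappaHyp — the displayed published statement of the (A″κ) layer (Tier 6, M2; statement lane)

One display over the convention-character carriers `Kd : KappaDatum Sp` (T6N41PlaceKappa): Rao 1993, Corollary
A.5 (1) — the scaling rule of the Weil-index quotient `γ_F(a, η)` under `η ↦ cη`, `γ_F(a, cη) = (a, c)_F γ_F(a, η)`
— the printed fact by which the residual `κ′(ϖ_v)⁻¹` of Lemma A′-4 (the ratio of the Weil-index factors of GR91
(3.1.2) and (3.1.3) with `η = tψ_v`) becomes the Hilbert symbol `(ϖ_v, t)_v`, i.e. the `v`-component of the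
quadratic Hecke character `κ_F = (·, t)_𝔸` (TIER5 §N4.1.10 (a)/(b4)).  `def … : Prop` only; consumed by name in
`T6N41PlaceKappaMain.kappa_eq_hilbert` / `hκ_of_kappa` / `N41_placement_kappa`.

Quote layer: THE JOURNAL PRINT — R. Ranga Rao, Pacific J. Math. 157 (1993) 335–371, the MSP scan fetched under
README §9(i) (route/t6-lit-fetched/Rao1993-PJM157-2-335-371-msp-pjm-v157-n2-p09-s.pdf, sha256
0492692a830988181ac942e519c1b5be0ac920fd61b6769157643b1242770507; print p. = pdf + 333; §9(iii) referee re-hash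
ref-4 STATUS l. 5016, 3/3 MISMATCH 0 — t6-lit card C50), read BY EYE on the renders
route/t6-lit-renders/Rao1993-PJM157/p366-pdf033.png and p367-pdf034.png by this seat (2026-08-25T20:5xZ); the
store's OCR layer paper:doi-10-2140-pjm-1993-157-335 (p0034 = p. 367) garbles the displays and is cited for
locating only.  v2 (docstrings only — the QA-t6lit-82 paste and its gloss nit; `def` byte-identical to v1 p408280).

§8(d): uses an L-value-free non-vanishing device: NO.
-/

namespace Summit.Ventures.HodgeRepro2.T6
namespace Hyp

variable {ι : Type*}

/-- [cite: Rao1993, R. Ranga Rao, «On some explicit formulas in the theory of Weil representation», Pacific J.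
Math. 157 (1993), no. 2, 335–371, Appendix, Corollary A.5 (1), p. 367 (render p367-pdf034.png: the corollary
follows Theorem A.4 after the sentence «The following corollary is immediate.»; standing §A.3 = p. 366 last
paragraph and p. 367 ll. 1–5)] STANDING (p. 366, last paragraph): «A.3. For
the remainder of the Appendix, let F be a self-dual locally compact field with char F ≠ 2, i.e. F is either a
finite field or a local field. For the material of this part see Weil [16], Saito [12], Rallis and Schiffman
[11].» (p. 367 ll. 1–5): «Let η be a nontrivial continuous character of (F, +). For any a ∈ F, we write aη for
the character aη: x → η(ax). Define» / «γ_F(η) = Weil index of: x → η(x²),» / «γ_F(a, η) = γ_F(aη)/γ_F(η),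
a ∈ F^×.» / «The main theorem on the γ_F(a, η) is the following (see Weil [16], p. 176).» THEOREM A.4 (p. 367; the
end of its statement, for the meaning of the symbol `(a, b)_F`): «… and moreover» / «γ_F(ab, η)γ_F(a, η)^{−1}
γ_F(b, η)^{−1} = (a, b)_F» / «where (a, b)_F is the Hilbert symbol of F i.e.» / «(a, b)_F = { +1 if a is a norm
in F(√b), / −1 otherwise.» THE STATEMENT (p. 367): «The following corollary is immediate.» / «COROLLARY A.5.
(1) γ_F(a, cη) = (a, c)_F γ_F(a, η).» [display: the subscripts and superscripts of the print are set as `_` / `^`,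
the printed italics are not reproduced, the case-brace of the Hilbert-symbol definition is written on one line;
the first sentence of Theorem A.4 (`γ_F(ac², η) = γ_F(a, η)`, the second-degree-character clause) and the clauses
(2)–(4) of Corollary A.5 are not displayed.  Instantiation: `F = F_v` for a place `v` of the route's `F` (a local
field of characteristic `0`, hence `char F ≠ 2`; the display quantifies over every `v : ι`), `η` ranging over the
carrier `Kd.AddCh v` of the nontrivial continuous characters of `(F_v, +)`, `a`, `c` over `Kd.Fx v` = `F_v^×`;
`cη` = `Kd.smul v c η`, `(a, c)_F` = `Kd.hilbert v a c`, `γ_F(a, η)` = `Kd.γF v a η` (both valued in `ℂˣ`: the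
Hilbert symbol is `±1`, the Weil-index quotient a fourth root of unity by Cor. A.5 (4), `{γ_F(a, η)}⁴ = 1`); the equation is the
printed one with the multiplication in `ℂˣ`.  FAITHFUL on the carriers (no weakening, no strengthening): the
carriers are abstract, so the display says exactly the printed identity for every `a`, `c`, `η` of the
carriers.] [cite-class: print (the MSP journal scan, read by eye on the render; referee re-hash ref-4 l. 5016)]
[quote-audit: QA-t6lit-82 — EXACT BY EYE 7/7 on the journal print (STATUS l. 11413; §A.3 standing p. 366, p. 367
ll. 1–5, Theorem A.4's tail with the one-line case brace, «The following corollary is immediate.», Corollary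
A.5 (1)); locators and the carrier instantiation FAITHFUL; t6-lit's 300-dpi re-render confirms the print's
«F^×/(F^×)» carries NO exponent (a journal misprint, C50 ERRATUM) — hence not quoted here; the gloss nit
«eighth root» → «fourth root» applied in this v2 (docstrings only; the statement byte-identical to v1
p408280)] -/
def Rao1993_CorA5_1 {D : DoublingLDatum ι} {Pl : PlacementDatum D} {In : InertDatum Pl}
    {Sp : SplitDatum In} (Kd : KappaDatum Sp) : Prop :=
  ∀ v, ∀ a c : Kd.Fx v, ∀ η : Kd.AddCh v, Kd.γF v a (Kd.smul v c η) = Kd.hilbert v a c * Kd.γF v a η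

#check @Rao1993_CorA5_1

end Hyp
end Summit.Ventures.HodgeRepro2.T6
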